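import Summits.HodgeConjecture.HodgeConjecture.Theses.PeriodDeficiency
import Summits.HodgeConjecture.HodgeConjecture.Theses.MotivatedLefschetzSplit
import Summits.HodgeConjecture.HodgeConjecture.Theorems.PeriodDeficiencyHodgeConjectureQbarStubLefschetzRange
import Summits.HodgeConjecture.HodgeConjecture.Theorems.PeriodDeficiencyHodgeConjectureQbarStubLefschetzTransfer
import Literature.AlgebraicGeometry.HodgeTheory.MotivatedClassesProofs

/-!
# Skeleton of the crux `HodgeConjectureQbar` — line `registered` (birth), RESHAPED by codimension range

Crux `stmt-HodgeConjecture-11596` of route `PeriodDeficiency`: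

  `HodgeConjectureQbar := ∀ (σ : ℚ̄ →+* ℂ) n X₀, IsSmoothProjective n (X₀ ×_{ℚ̄,σ} ℂ) →
     HodgeConjectureFor n (X₀ ×_{ℚ̄,σ} ℂ)`

(the Hodge conjecture, on the real carriers, for smooth projective complex varieties with a
`ℚ̄`-model). The birth skeleton (planner, `Lines/birth.lean` @7b599d8da78f) cut it along André's
motivated classes into `stub_hodgeClassesMotivatedQbar` (rational `(p,p)`-classes are motivated) and
`stub_motivatedClassesAlgebraicQbar` (motivated classes are algebraic), in EVERY codimension `p`.
Both halves are open-problem-sized as filed, but each contains a range of codimensions that is a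
THEOREM of the tree's real-carrier layer. The lead's reshape (same composition idea — André's cut —
kept exactly where it has content) separates the codimensions:

* `stub_hodgeClassesAlgebraicQbar_lefschetzRange` — the LEFSCHETZ RANGE `p ≤ 1 ∨ n ≤ p + 1`
  (so every `p` when `n ≤ 3`): a rational `(p,p)`-class is algebraic outright — `p = 0`
  (`N⁰ H⁰ = H⁰`), `p = 1` (Lefschetz `(1,1)`, tree theorem `lefschetzOneOne_rational_holds`),
  `n < 2p` with `n − p ≤ 1` (hard Lefschetz, tree theorem `nonempty_hardLefschetzNFold_holds`, via
  `mem_algebraicClasses_of_lt_of_nonempty`), `p > n` (`c = 0`); assembled in the tree as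
  `mem_algebraicClasses_of_lefschetzRange`. KNOWN — LANDED p147191 (sorry replaced).
* `stub_hodgeClassesMotivatedQbar_deepMiddle` — THE ARITHMETIC / TRANSCENDENCE HALF in the deep
  middle range `2 ≤ p`, `2p ≤ n` (`n ≥ 4`): every rational `(p,p)`-class on `X₀ ×_{ℚ̄,σ} ℂ` is
  motivated (André 1996 §0.4 expectation restricted to `ℚ̄`-varieties; Thm. 0.6.2 for abelian
  varieties) — VERBATIM the restriction to `ℚ̄`-models of crux
  `MotivatedLefschetzSplit.HodgeClassesMotivated` (stmt-HodgeConjecture-17488). OPEN.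
* `stub_lefschetzTransferMotivatedQbar` — the other half `n < 2p ≤ 2n − 4` of the middle range
  from the deep half ON THE SAME `X`, by hard Lefschetz on Hodge classes (`exists_hdg_preimage`,
  `nonempty_hardLefschetzNFold_holds`) and the stability of `A_mot(X)` under `L` (André Prop. 2.1
  (i), divisor case — unconditional via `stub_cupProductAlgebraicDivisor`). KNOWN — LANDED p150101 (sorry replaced).
* `stub_motivatedClassesAlgebraicQbar_middle` — THE ALGEBRAIC-CYCLES HALF in the middle range:
  `A_motᵖ(X)_ℂ ≤ Nᵖ H²ᵖ(X(ℂ); ℂ)` for `2 ≤ p ≤ n − 2` (André §2.1 remark: follows from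
  Grothendieck's `B`; tree: `Andre1996_motivatedClasses_le_algebraicClasses_of_standardConjectureB`,
  proved modulo multiplicativity in `MotivatedClassesAssembly`). OPEN.
* `hodgeClassesMotivatedQbar_middle_of_deep` (no `sorry`): deep half + transfer give "rational
  `(p,p)` ⇒ motivated" on the whole middle range `2 ≤ p ≤ n − 2`.
* `hodgeClassesAlgebraicQbar_of_ranges` (no `sorry`): with stubs A and C, "rational `(p,p)` ⇒
  algebraic" in every codimension (case split `p ≤ 1 ∨ n ≤ p + 1` / `2 ≤ p ≤ n − 2`).
* `HodgeConjectureQbar_of` (no `sorry`): that and the PROVED route item `HodgeModelsExist_holds`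
  (anti-vacuity conjunct) give the crux, concluded BY NAME; `HodgeConjectureQbar_of_stubs` composes.
* HINGES (no `sorry`; where the two open stubs sit in the hub): `stub_hodgeClassesMotivatedQbar_deepMiddle_of_item`
  — stub B is the specialisation to `ℚ̄`-models of crux `MotivatedLefschetzSplit.HodgeClassesMotivated`
  (stmt-HodgeConjecture-17488); `stub_motivatedClassesAlgebraicQbar_middle_of_items` — stub C follows
  from cruxes `MotivatedLefschetzSplit.LefschetzStandardB` (stmt-HodgeConjecture-17489, Grothendieck's
  `B` for all complex `Z`) and `MotivatedLefschetzSplit.DiagonalPullbackAlgebraic`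
  (stmt-HodgeConjecture-17490, Voisin II Prop. 9.21 (i)) by the tree's PROVED reduction
  `motivatedClasses_le_algebraicClasses_of_standardConjectureB_of_map_diagonal`; the resulting
  bridge (crux ⟸ those three items + the landed stubs A, D) is the Theorems file
  `PeriodDeficiencyHodgeConjectureQbarOfMotivatedLefschetzSplit` (p151474, conditional result).

`sorry` occurs only inside the two OPEN `stub_*` theorems (B, C); A and D are closed by landed Theorems files.
-/

set_option linter.dupNamespace false

namespace Summit.HodgeConjecture.HodgeConjecture.Cruxes.HodgeConjectureQbar.Birth

open Literature.AlgebraicGeometry.Motives Literature.AlgebraicGeometry.HodgeTheory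
open Summit.HodgeConjecture.HodgeConjecture.Theses.PeriodDeficiency

/-- **Stub A — the Lefschetz range is algebraic** (KNOWN): for every embedding `σ : ℚ̄ →+* ℂ`,
every smooth projective `X = X₀ ×_{ℚ̄,σ} ℂ` of dimension `n` and every codimension `p` with
`p ≤ 1 ∨ n ≤ p + 1`, every rational class of Hodge type `(p,p)` in `H²ᵖ(X(ℂ); ℂ)` is algebraic
(`∈ Nᵖ H²ᵖ`). Tree: `mem_algebraicClasses_of_lefschetzRange` with `lefschetzOneOne_rational_holds`
and `nonempty_hardLefschetzNFold_holds`. LANDED (p147191,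
`Theorems/PeriodDeficiencyHodgeConjectureQbarStubLefschetzRange`): the `sorry` is replaced by the
tree theorem of the same name. [VoisinHodgeI2002 Thm. 6.25, Thm. 11.30; Murre1977 Rem. 1] -/
theorem stub_hodgeClassesAlgebraicQbar_lefschetzRange :
    ∀ (σ : AlgebraicClosure ℚ →+* ℂ) ⦃n : ℕ⦄ ⦃X₀ : SchemeOver (AlgebraicClosure ℚ)⦄,
      IsSmoothProjective n ((baseChangeHom σ).obj X₀) →
        ∀ (p : ℕ), (p ≤ 1 ∨ n ≤ p + 1) →
          ∀ (c : complexBetti ((baseChangeHom σ).obj X₀) (2 * p)),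
            IsRationalClass c → IsOfHodgeType n ((baseChangeHom σ).obj X₀) (2 * p) p p c →
              c ∈ algebraicClasses ((baseChangeHom σ).obj X₀) p :=
  Summit.HodgeConjecture.HodgeConjecture.Theorems.stub_hodgeClassesAlgebraicQbar_lefschetzRange

/-- **Stub B — Hodge classes of the deep middle range on `ℚ̄`-varieties are motivated** (the
arithmetic half, OPEN): for every embedding `σ : ℚ̄ →+* ℂ`, every smooth projective
`X = X₀ ×_{ℚ̄,σ} ℂ` of dimension `n` and every `p` with `2 ≤ p`, `2p ≤ n`, every rational class of
Hodge type `(p,p)` in `H²ᵖ(X(ℂ); ℂ)` lies in André's `A_motᵖ(X)_ℂ = motivatedClasses n X p`.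
Verbatim the restriction to `ℚ̄`-models of crux `MotivatedLefschetzSplit.HodgeClassesMotivated`
(stmt-HodgeConjecture-17488, all complex `X`).
[Andre1996Motifs §0.4, Thm. 0.6.2, Prop. 2.5.1, §4; Deligne1982HodgeCycles; Andre2004 ch. 7, 23–24] -/
theorem stub_hodgeClassesMotivatedQbar_deepMiddle :
    ∀ (σ : AlgebraicClosure ℚ →+* ℂ) ⦃n : ℕ⦄ ⦃X₀ : SchemeOver (AlgebraicClosure ℚ)⦄,
      IsSmoothProjective n ((baseChangeHom σ).obj X₀) →
        ∀ (p : ℕ), 2 ≤ p → 2 * p ≤ n →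
          ∀ (c : complexBetti ((baseChangeHom σ).obj X₀) (2 * p)),
            IsRationalClass c → IsOfHodgeType n ((baseChangeHom σ).obj X₀) (2 * p) p p c →
              c ∈ motivatedClasses n ((baseChangeHom σ).obj X₀) p := by
  sorry

/-- **Stub D — hard-Lefschetz transfer of motivated-ness above the middle degree** (KNOWN): for
every embedding `σ : ℚ̄ →+* ℂ` and every smooth projective `X = X₀ ×_{ℚ̄,σ} ℂ` of dimension `n`,
if the rational `(q,q)`-classes of `X` with `2 ≤ q`, `2q ≤ n` are motivated, then so are the
rational `(p,p)`-classes with `n < 2p`, `p + 2 ≤ n`: `c = Lʲ c'` for a rational `(n−p,n−p)`-class `c'`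
(hard Lefschetz on Hodge classes, Voisin I Thm. 6.25 / Rem. 6.27; tree `exists_hdg_preimage` with
`nonempty_hardLefschetzNFold_holds`), `c'` is motivated by hypothesis, and `A_mot(X)` is stable under
`L` (André Prop. 2.1 (i), divisor case, unconditional in the tree via `stub_cupProductAlgebraicDivisor`).
LANDED (p150101, `Theorems/PeriodDeficiencyHodgeConjectureQbarStubLefschetzTransfer`): the `sorry` is
replaced by the tree theorem of the same name.
[VoisinHodgeI2002 Thm. 6.25, Rem. 6.27, §7.1.2; Andre1996Motifs Prop. 2.1] -/
theorem stub_lefschetzTransferMotivatedQbar :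
    ∀ (σ : AlgebraicClosure ℚ →+* ℂ) ⦃n : ℕ⦄ ⦃X₀ : SchemeOver (AlgebraicClosure ℚ)⦄,
      IsSmoothProjective n ((baseChangeHom σ).obj X₀) →
        (∀ (q : ℕ), 2 ≤ q → 2 * q ≤ n →
          ∀ (c : complexBetti ((baseChangeHom σ).obj X₀) (2 * q)),
            IsRationalClass c → IsOfHodgeType n ((baseChangeHom σ).obj X₀) (2 * q) q q c →
              c ∈ motivatedClasses n ((baseChangeHom σ).obj X₀) q) →
        ∀ (p : ℕ), n < 2 * p → p + 2 ≤ n →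
          ∀ (c : complexBetti ((baseChangeHom σ).obj X₀) (2 * p)),
            IsRationalClass c → IsOfHodgeType n ((baseChangeHom σ).obj X₀) (2 * p) p p c →
              c ∈ motivatedClasses n ((baseChangeHom σ).obj X₀) p :=
  Summit.HodgeConjecture.HodgeConjecture.Theorems.stub_lefschetzTransferMotivatedQbar

/-- **Glue for the arithmetic half** (kernel-checked, no `sorry`): the deep half (stub B) and the
hard-Lefschetz transfer (stub D) give "rational `(p,p)` ⇒ motivated" on the whole middle range
`2 ≤ p ≤ n − 2` (case split `2p ≤ n` / `n < 2p`). -/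
theorem hodgeClassesMotivatedQbar_middle_of_deep
    (hB : ∀ (σ : AlgebraicClosure ℚ →+* ℂ) ⦃n : ℕ⦄ ⦃X₀ : SchemeOver (AlgebraicClosure ℚ)⦄,
      IsSmoothProjective n ((baseChangeHom σ).obj X₀) →
        ∀ (p : ℕ), 2 ≤ p → 2 * p ≤ n →
          ∀ (c : complexBetti ((baseChangeHom σ).obj X₀) (2 * p)),
            IsRationalClass c → IsOfHodgeType n ((baseChangeHom σ).obj X₀) (2 * p) p p c →
              c ∈ motivatedClasses n ((baseChangeHom σ).obj X₀) p)
    (hD : ∀ (σ : AlgebraicClosure ℚ →+* ℂ) ⦃n : ℕ⦄ ⦃X₀ : SchemeOver (AlgebraicClosure ℚ)⦄,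
      IsSmoothProjective n ((baseChangeHom σ).obj X₀) →
        (∀ (q : ℕ), 2 ≤ q → 2 * q ≤ n →
          ∀ (c : complexBetti ((baseChangeHom σ).obj X₀) (2 * q)),
            IsRationalClass c → IsOfHodgeType n ((baseChangeHom σ).obj X₀) (2 * q) q q c →
              c ∈ motivatedClasses n ((baseChangeHom σ).obj X₀) q) →
        ∀ (p : ℕ), n < 2 * p → p + 2 ≤ n →
          ∀ (c : complexBetti ((baseChangeHom σ).obj X₀) (2 * p)),
            IsRationalClass c → IsOfHodgeType n ((baseChangeHom σ).obj X₀) (2 * p) p p c →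
              c ∈ motivatedClasses n ((baseChangeHom σ).obj X₀) p) :
    ∀ (σ : AlgebraicClosure ℚ →+* ℂ) ⦃n : ℕ⦄ ⦃X₀ : SchemeOver (AlgebraicClosure ℚ)⦄,
      IsSmoothProjective n ((baseChangeHom σ).obj X₀) →
        ∀ (p : ℕ), 2 ≤ p → p + 2 ≤ n →
          ∀ (c : complexBetti ((baseChangeHom σ).obj X₀) (2 * p)),
            IsRationalClass c → IsOfHodgeType n ((baseChangeHom σ).obj X₀) (2 * p) p p c →
              c ∈ motivatedClasses n ((baseChangeHom σ).obj X₀) p := by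
  intro σ n X₀ hX p hp2 hpn c hc hpp
  by_cases h : 2 * p ≤ n
  · exact hB σ hX p hp2 h c hc hpp
  · exact hD σ hX (fun q hq2 hqn c' hc' hqq ↦ hB σ hX q hq2 hqn c' hc' hqq) p (by omega) hpn c hc hpp

/-- **Stub C — motivated classes of the middle range on `ℚ̄`-varieties are algebraic** (the
algebraic-cycles half, Grothendieck's `B` in André's reading, OPEN): for every embedding
`σ : ℚ̄ →+* ℂ`, every smooth projective `X = X₀ ×_{ℚ̄,σ} ℂ` of dimension `n` and every `p` with
`2 ≤ p ≤ n − 2`, `A_motᵖ(X)_ℂ ≤ Nᵖ H²ᵖ(X(ℂ); ℂ) = algebraicClasses X p`.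
[Andre1996Motifs §0.3, §2.1 remark following Déf. 1, Prop. 1.2; Grothendieck1968 §3; Kleiman1968;
VoisinHodgeII2003 Prop. 9.20–9.21] -/
theorem stub_motivatedClassesAlgebraicQbar_middle :
    ∀ (σ : AlgebraicClosure ℚ →+* ℂ) ⦃n : ℕ⦄ ⦃X₀ : SchemeOver (AlgebraicClosure ℚ)⦄,
      IsSmoothProjective n ((baseChangeHom σ).obj X₀) →
        ∀ p : ℕ, 2 ≤ p → p + 2 ≤ n →
          motivatedClasses n ((baseChangeHom σ).obj X₀) p ≤
            algebraicClasses ((baseChangeHom σ).obj X₀) p := by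
  sorry

/-- **Glue, implication form** (kernel-checked, no `sorry`): the three range stubs give "every
rational `(p,p)`-class on a smooth projective `X₀ ×_{ℚ̄,σ} ℂ` is algebraic" in EVERY codimension:
in the Lefschetz range `p ≤ 1 ∨ n ≤ p + 1` by stub A, and in the middle range `2 ≤ p ≤ n − 2` the
class is motivated (stub B), hence algebraic (stub C). -/
theorem hodgeClassesAlgebraicQbar_of_ranges
    (hA : ∀ (σ : AlgebraicClosure ℚ →+* ℂ) ⦃n : ℕ⦄ ⦃X₀ : SchemeOver (AlgebraicClosure ℚ)⦄,
      IsSmoothProjective n ((baseChangeHom σ).obj X₀) →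
        ∀ (p : ℕ), (p ≤ 1 ∨ n ≤ p + 1) →
          ∀ (c : complexBetti ((baseChangeHom σ).obj X₀) (2 * p)),
            IsRationalClass c → IsOfHodgeType n ((baseChangeHom σ).obj X₀) (2 * p) p p c →
              c ∈ algebraicClasses ((baseChangeHom σ).obj X₀) p)
    (hB : ∀ (σ : AlgebraicClosure ℚ →+* ℂ) ⦃n : ℕ⦄ ⦃X₀ : SchemeOver (AlgebraicClosure ℚ)⦄,
      IsSmoothProjective n ((baseChangeHom σ).obj X₀) →
        ∀ (p : ℕ), 2 ≤ p → p + 2 ≤ n →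
          ∀ (c : complexBetti ((baseChangeHom σ).obj X₀) (2 * p)),
            IsRationalClass c → IsOfHodgeType n ((baseChangeHom σ).obj X₀) (2 * p) p p c →
              c ∈ motivatedClasses n ((baseChangeHom σ).obj X₀) p)
    (hC : ∀ (σ : AlgebraicClosure ℚ →+* ℂ) ⦃n : ℕ⦄ ⦃X₀ : SchemeOver (AlgebraicClosure ℚ)⦄,
      IsSmoothProjective n ((baseChangeHom σ).obj X₀) →
        ∀ p : ℕ, 2 ≤ p → p + 2 ≤ n →
          motivatedClasses n ((baseChangeHom σ).obj X₀) p ≤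
            algebraicClasses ((baseChangeHom σ).obj X₀) p) :
    ∀ (σ : AlgebraicClosure ℚ →+* ℂ) ⦃n : ℕ⦄ ⦃X₀ : SchemeOver (AlgebraicClosure ℚ)⦄,
      IsSmoothProjective n ((baseChangeHom σ).obj X₀) →
        ∀ (p : ℕ) (c : complexBetti ((baseChangeHom σ).obj X₀) (2 * p)),
          IsRationalClass c → IsOfHodgeType n ((baseChangeHom σ).obj X₀) (2 * p) p p c →
            c ∈ algebraicClasses ((baseChangeHom σ).obj X₀) p := by
  intro σ n X₀ hX p c hc hpp
  by_cases hp : p ≤ 1 ∨ n ≤ p + 1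
  · exact hA σ hX p hp c hc hpp
  · exact hC σ hX p (by omega) (by omega) (hB σ hX p (by omega) (by omega) c hc hpp)

/-- **Assembly, implication form** (kernel-checked, no `sorry`): the three range stubs imply the
crux `PeriodDeficiency.HodgeConjectureQbar` — the anti-vacuity conjunct `Nonempty (HodgeModel n X)`
of `HodgeConjectureFor` by the PROVED route item `HodgeModelsExist_holds` (Serre GAGA + de Rham +
Hodge decomposition, stmt-HodgeConjecture-2742), and "rational `(p,p)` ⇒ algebraic" by
`hodgeClassesAlgebraicQbar_of_ranges`. -/
theorem HodgeConjectureQbar_of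
    (hA : ∀ (σ : AlgebraicClosure ℚ →+* ℂ) ⦃n : ℕ⦄ ⦃X₀ : SchemeOver (AlgebraicClosure ℚ)⦄,
      IsSmoothProjective n ((baseChangeHom σ).obj X₀) →
        ∀ (p : ℕ), (p ≤ 1 ∨ n ≤ p + 1) →
          ∀ (c : complexBetti ((baseChangeHom σ).obj X₀) (2 * p)),
            IsRationalClass c → IsOfHodgeType n ((baseChangeHom σ).obj X₀) (2 * p) p p c →
              c ∈ algebraicClasses ((baseChangeHom σ).obj X₀) p)
    (hB : ∀ (σ : AlgebraicClosure ℚ →+* ℂ) ⦃n : ℕ⦄ ⦃X₀ : SchemeOver (AlgebraicClosure ℚ)⦄,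
      IsSmoothProjective n ((baseChangeHom σ).obj X₀) →
        ∀ (p : ℕ), 2 ≤ p → p + 2 ≤ n →
          ∀ (c : complexBetti ((baseChangeHom σ).obj X₀) (2 * p)),
            IsRationalClass c → IsOfHodgeType n ((baseChangeHom σ).obj X₀) (2 * p) p p c →
              c ∈ motivatedClasses n ((baseChangeHom σ).obj X₀) p)
    (hC : ∀ (σ : AlgebraicClosure ℚ →+* ℂ) ⦃n : ℕ⦄ ⦃X₀ : SchemeOver (AlgebraicClosure ℚ)⦄,
      IsSmoothProjective n ((baseChangeHom σ).obj X₀) →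
        ∀ p : ℕ, 2 ≤ p → p + 2 ≤ n →
          motivatedClasses n ((baseChangeHom σ).obj X₀) p ≤
            algebraicClasses ((baseChangeHom σ).obj X₀) p) :
    Summit.HodgeConjecture.HodgeConjecture.Theses.PeriodDeficiency.HodgeConjectureQbar := by
  unfold Summit.HodgeConjecture.HodgeConjecture.Theses.PeriodDeficiency.HodgeConjectureQbar
  intro σ n X₀ hX
  exact ⟨HodgeModelsExist_holds n _ hX,
    fun p c hc hpp ↦ hodgeClassesAlgebraicQbar_of_ranges hA hB hC σ hX p c hc hpp⟩

/-! ### Hinges: where the two OPEN stubs sit in the hub (kernel-checked, no `sorry`) -/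

/-- **Stub B is the `ℚ̄`-specialisation of crux `HodgeClassesMotivated`** (route
`MotivatedLefschetzSplit`, stmt-HodgeConjecture-17488: on EVERY smooth projective complex `X`,
rational `(p,p)`-classes with `2 ≤ p`, `2p ≤ n` are motivated): that item implies stub B verbatim
(take `X = X₀ ×_{ℚ̄,σ} ℂ`). The converse is not claimed: stub B is the `ℚ̄`-definable case only,
where arithmetic engines (absolute Hodge classes, André's motivated Galois group and the period
conjecture — route `PeriodsPolice`, items stmt-HodgeConjecture-14651/14652) also bear. -/
theorem stub_hodgeClassesMotivatedQbar_deepMiddle_of_item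
    (hHM : Summit.HodgeConjecture.HodgeConjecture.Theses.MotivatedLefschetzSplit.HodgeClassesMotivated) :
    ∀ (σ : AlgebraicClosure ℚ →+* ℂ) ⦃n : ℕ⦄ ⦃X₀ : SchemeOver (AlgebraicClosure ℚ)⦄,
      IsSmoothProjective n ((baseChangeHom σ).obj X₀) →
        ∀ (p : ℕ), 2 ≤ p → 2 * p ≤ n →
          ∀ (c : complexBetti ((baseChangeHom σ).obj X₀) (2 * p)),
            IsRationalClass c → IsOfHodgeType n ((baseChangeHom σ).obj X₀) (2 * p) p p c →
              c ∈ motivatedClasses n ((baseChangeHom σ).obj X₀) p :=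
  fun _ _ _ hX p hp2 hpn c hc hpp ↦ hHM hX p hp2 hpn c hc hpp

/-- **Stub C follows from cruxes `LefschetzStandardB` and `DiagonalPullbackAlgebraic`** (route
`MotivatedLefschetzSplit`, stmt-HodgeConjecture-17489 = Grothendieck's standard conjecture of
Lefschetz type in André's `*_L`-form for every smooth projective complex `Z`, and
stmt-HodgeConjecture-17490 = Voisin II Prop. 9.21 (i): diagonal pull-back preserves the coniveau),
by the tree's PROVED reduction `motivatedClasses_le_algebraicClasses_of_standardConjectureB_of_map_diagonal`
(André 1996 §2.1 remark made explicit: `*_L β = γ^* β` algebraic, multiplicativity from `Δ^*`,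
Gysin push-forward preserves supports) — in every codimension, in particular in the middle range.
(Worker census, wave 1: no unconditional road; `StandardConjectureBStar` is the hinge, and even the
below-middle generators need the general-bidegree multiplicativity, i.e. stmt-17490 / Roberts 1972.) -/
theorem stub_motivatedClassesAlgebraicQbar_middle_of_items
    (hB : Summit.HodgeConjecture.HodgeConjecture.Theses.MotivatedLefschetzSplit.LefschetzStandardB)
    (hΔ : Summit.HodgeConjecture.HodgeConjecture.Theses.MotivatedLefschetzSplit.DiagonalPullbackAlgebraic) :
    ∀ (σ : AlgebraicClosure ℚ →+* ℂ) ⦃n : ℕ⦄ ⦃X₀ : SchemeOver (AlgebraicClosure ℚ)⦄,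
      IsSmoothProjective n ((baseChangeHom σ).obj X₀) →
        ∀ p : ℕ, 2 ≤ p → p + 2 ≤ n →
          motivatedClasses n ((baseChangeHom σ).obj X₀) p ≤
            algebraicClasses ((baseChangeHom σ).obj X₀) p :=
  fun _ _ _ hX p _ _ ↦
    motivatedClasses_le_algebraicClasses_of_standardConjectureB_of_map_diagonal hΔ hB hX p

-- The bridge `HodgeClassesMotivated → LefschetzStandardB → DiagonalPullbackAlgebraic → HodgeConjectureQbar`
-- (the crux from the three `MotivatedLefschetzSplit` items and the landed stubs A, D; sorry-free) is LANDED as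
-- `Summit.HodgeConjecture.HodgeConjecture.Theorems.periodDeficiency_hodgeConjectureQbar_of_motivatedLefschetzSplit`
-- (`Theorems/PeriodDeficiencyHodgeConjectureQbarOfMotivatedLefschetzSplit.lean`, p151474, conditional result on
-- stmt-HodgeConjecture-11596); it is not repeated here so that the registrar's deciding theorem stays
-- `HodgeConjectureQbar_of_stubs` (closed iff stubs B and C land).

/-! ### The deciding composition (closed iff stubs B and C land) -/

/-- **The crux from its registered stubs, by name** (no `sorry` of its own; its closure is
conditional on the four `stub_*` placeholders until they are proved). -/
theorem HodgeConjectureQbar_of_stubs :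
    Summit.HodgeConjecture.HodgeConjecture.Theses.PeriodDeficiency.HodgeConjectureQbar :=
  HodgeConjectureQbar_of stub_hodgeClassesAlgebraicQbar_lefschetzRange
    (hodgeClassesMotivatedQbar_middle_of_deep stub_hodgeClassesMotivatedQbar_deepMiddle
      stub_lefschetzTransferMotivatedQbar)
    stub_motivatedClassesAlgebraicQbar_middle

end Summit.HodgeConjecture.HodgeConjecture.Cruxes.HodgeConjectureQbar.Birth
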